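import Literature.IUT.HodgeArakelov.ProfiniteGroupificationsNonVacuity
import Literature.IUT.HodgeArakelov.AbsTopMonoidsGenuineProducer
import Mathlib.GroupTheory.MonoidLocalization.GrothendieckGroup
import HarnessLib

/-!
# [IUTchII] Example 1.8 (vii): the interface `ProfiniteGroupifications` inhabited by the GENUINE groupifications `(*gp)`
# over every `AbsTopMonoids` with cancellative monoids — in particular over abc-iut-L6-t13's GENUINE `𝒪_k̄^⊳` producer

Mochizuki, *Inter-universal Teichmüller theory II*, §1, Example 1.8 (vii), kurims manuscript (Dec. 2020) p. 40
[claim: Mochizuki2012, status: disputed] (IUTchII §1 Ex 1.8 (vii), kurims p.40): the algorithms "`(*gp) Π ↦ (Π ↷ M^gp_TM(Π));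
G ↦ (G ↷ O^gp(G))`" (groupifications) and "`(*ĝp)`" (inductive limits of profinite completions of the `J`-invariants), the
natural inclusion `O^×(G) ↪ O^ĝp(G)` and the poly-isomorphism `α_ĝp` "compatible … with `α_×`". PROOF-ONLY companion (no `def`,
no `instance`, no `structure`) of abc-iut-w5-d193's `ProfiniteGroupificationsNonVacuity.lean` (p419261: DEGENERATE witness — all
carriers trivial — plus the exact ∃-condition (H1)∧(H2)), row NV-L6-UPGRADE ProfiniteGroupifications@genuineOfModel (abc-iut-w5-d193
gen 3; L6-lead §F v1.19a (3) / v1.19c «only GENUINE upgrades count»), for abc-iut-L6-t1's interface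
`Literature.IUT.HodgeArakelov.ProfiniteGroupifications A Γ` (`AbsTopInterfaces.lean`).

What the kernel says:

* `ProfiniteGroupifications.nonempty_of_isCancelMul` — over ANY `A : AbsTopMonoids S` whose monoids `O^⊳(G)` are CANCELLATIVE and
  any group `Γ`, the interface is inhabited by the GENUINE GROUPIFICATIONS: `O^ĝp(G) :=` the Grothendieck group
  `Localization ⊤ (O^⊳(G))` of Mathlib (= the interface's own `AbsTopMonoids.Ogp G`, `(*gp)`), `O^×(G) ↪ O^gp(G)` the composite
  `O^×(G) ⊆ O^⊳(G) → O^gp(G)` — INJECTIVE exactly because `O^⊳(G)` is cancellative (`Algebra.GrothendieckGroup.of_injective`) —,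
  `M^ĝp_TM(Π) := M_TM(Π)^gp` with its canonical map, and `α_ĝp :=` the groupification of the tautological isomorphism `(*TM⊳)`
  `M_TM(Π) ≅ O^⊳(Π/Δ)` (`Submonoid.LocalizationMap.mulEquivOfMulEquiv`), whose compatibility with `α_×` on units
  (`alphaGhat_compat`) is PROVED (`mulEquivOfMulEquiv_eq`);
* `ProfiniteGroupifications.isCancelMul_nonzeroIntegers` — `𝒪_k̄^⊳` (abc-iut-L4's `ModelMLFGaloisData.nonzeroIntegers k K`, the
  non-zero integers of `k̄` as a submonoid of the field `k̄`) is cancellative;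
* `ProfiniteGroupifications.nonempty_genuineOfModel` — hence over abc-iut-L6-t13's GENUINE producer
  `AbsTopMonoids.genuineOfModel S C ε hΔ hq` (p421397: `O^⊳(G) = 𝒪_k̄^⊳`, `M_TM(Π) = 𝒪_k̄^⊳`, genuine actions and transports) the
  interface `ProfiniteGroupifications` IS inhabited with `O^ĝp(G) = (𝒪_k̄^⊳)^gp` (`≅ k̄^×` abstractly) — for every `Γ`.

HONEST LABEL: `(*gp)` GENUINE (Grothendieck groups of the given monoids, injective on units); `(*ĝp) := (*gp)` — the printed
"inductive limit of profinite completions of the `J`-invariants" of the IND-TOPOLOGICAL modules is NOT modelled (abc-iut-L6-t1's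
interface carries the monoids WITHOUT their ind-topologies, so no completion finer than the identity is definable over it;
TODO-merge:abc-iut-L4-t3 [AbsTopIII] §5); the `Γ`-actions `:=` trivial (the interface records "a natural action of `Γ`" with no
law). An upgrade of the DEGENERATE witness p419261 (trivial carriers) to the genuine algebraic groupifications; nothing here
bears on [IUTchIII] Cor. 3.12; no side is taken; typed ≠ proved.
-/

namespace Literature.IUT.HodgeArakelov

open CategoryTheory
open Literature.AnabelianGeometry.AbsoluteAnabelian

universe u

namespace ProfiniteGroupifications

/-- **IUTchII:Ex1.8(vii)** (kurims p.40) **`(*gp)` GENUINE.** Over any `A : AbsTopMonoids S` with CANCELLATIVE monoids `O^⊳(G)` and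
any group `Γ`, `ProfiniteGroupifications A Γ` is inhabited by the Grothendieck groups: `O^ĝp(G) := O^gp(G) = Localization ⊤ (O^⊳(G))`
with the (injective, by cancellativity) inclusion of `O^×(G)`, `M^ĝp_TM(Π) := M_TM(Π)^gp`, `α_ĝp := (*TM⊳)^gp`, trivial `Γ`-actions;
`(*ĝp) := (*gp)` (completion not modelled). [claim: Mochizuki2012, status: disputed] (IUTchII §1 Ex 1.8 (vii), kurims p.40) -/
theorem nonempty_of_isCancelMul {S : ThetaSetting.{u}} (A : AbsTopMonoids S) (Γ : Type u) [Group Γ]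
    (hc : ∀ G : IsoClass S.Gk, IsCancelMul (A.Otri G)) : Nonempty (ProfiniteGroupifications A Γ) :=
  ⟨{ Oghat := fun G => Algebra.GrothendieckGroup (A.Otri G)
     unitsToOghat := fun G => (Algebra.GrothendieckGroup.of (M := A.Otri G)).comp (Units.coeHom (A.Otri G))
     unitsToOghat_injective := fun G _ _ h =>
       haveI := hc G
       Units.ext (Algebra.GrothendieckGroup.of_injective h)
     Mghat := fun P => Algebra.GrothendieckGroup (A.MTM P)
     toMghat := fun _ => Algebra.GrothendieckGroup.of
     actΓO := fun _ => 1
     actΓM := fun _ => 1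
     alphaGhat := fun P =>
       (Localization.monoidOf ⊤).mulEquivOfMulEquiv (Localization.monoidOf ⊤) (j := A.tauto P)
         (top_le_iff.mp fun x _ => ⟨(A.tauto P).symm x, trivial, (A.tauto P).apply_symm_apply x⟩)
     alphaGhat_compat := fun P m =>
       (Localization.monoidOf ⊤).mulEquivOfMulEquiv_eq
         (top_le_iff.mp fun x _ => ⟨(A.tauto P).symm x, trivial, (A.tauto P).apply_symm_apply x⟩) (m : A.MTM P) }⟩

/-- **IUTchII:Ex1.8(vii)** (kurims p.40) The carrier `O^ĝp(G)` of that witness IS the interface's own groupification `O^gp(G)`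
(`AbsTopMonoids.Ogp`, Mathlib's Grothendieck group) — definitionally. [claim: Mochizuki2012, status: disputed] (IUTchII §1 Ex 1.8 (vii), kurims p.40) -/
theorem grothendieckGroup_eq_Ogp {S : ThetaSetting.{u}} (A : AbsTopMonoids S) (G : IsoClass S.Gk) :
    Algebra.GrothendieckGroup (A.Otri G) = A.Ogp G := rfl

/-- `𝒪_k̄^⊳`, the monoid of non-zero integers of `k̄` (a submonoid of the field `k̄`), is cancellative.
[cite: MochizukiAbsTopIII2015, Definition 3.1 (i) p.66] -/
theorem isCancelMul_nonzeroIntegers (k K : Type u) [Field k] [ValuativeRel k] [Field K] [Algebra k K] :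
    IsCancelMul (nonzeroIntegers k K) where
  mul_left_cancel a _ _ h := Subtype.ext (mul_left_cancel₀ a.2.2 (congrArg Subtype.val h))
  mul_right_cancel a _ _ h := Subtype.ext (mul_right_cancel₀ a.2.2 (congrArg Subtype.val h))

/-- **IUTchII:Ex1.8(vii)** (kurims p.40) **At abc-iut-L6-t13's GENUINE producer** `AbsTopMonoids.genuineOfModel S C ε hΔ hq`
(`O^⊳(G) = 𝒪_k̄^⊳`, `M_TM(Π) = 𝒪_k̄^⊳`, p421397): the interface `ProfiniteGroupifications` is inhabited by the genuine
groupifications `O^ĝp(G) = (𝒪_k̄^⊳)^gp`, for every group `Γ` (`(*ĝp) := (*gp)`, trivial `Γ`-action — honest label in the module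
docstring). [claim: Mochizuki2012, status: disputed] (IUTchII §1 Ex 1.8 (vii), kurims p.40) -/
theorem nonempty_genuineOfModel (S : ThetaSetting.{0}) (C : MLFClosure.{0})
    (ε : S.Gk ≃ₜ* (ModelMLFGaloisData.galois C.k C.K).tmPair.Pi)
    (hΔ : ∀ f : S.PiX ≃ₜ* S.PiX, S.DeltaX.map f.toMulEquiv.toMonoidHom = S.DeltaX)
    (hq : Nonempty (TopGroup.quot S.PiX S.DeltaX ≃ₜ* S.Gk)) (Γ : Type) [Group Γ] :
    Nonempty (ProfiniteGroupifications (AbsTopMonoids.genuineOfModel S C ε hΔ hq) Γ) :=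
  nonempty_of_isCancelMul _ Γ fun _ => isCancelMul_nonzeroIntegers C.k C.K

/-- **IUTchII:Ex1.8(vii)** (kurims p.40) … so `∃ A : AbsTopMonoids S, Nonempty (ProfiniteGroupifications A Γ)` now has a witness
with GENUINE monoids AND genuine groupifications (abc-iut-w5-d193's `exists_nonempty_iff` had (H1)∧(H2) ⇒ a degenerate one).
[claim: Mochizuki2012, status: disputed] (IUTchII §1 Ex 1.8 (vii), kurims p.40) -/
theorem exists_nonempty_genuine (S : ThetaSetting.{0}) (C : MLFClosure.{0})
    (ε : S.Gk ≃ₜ* (ModelMLFGaloisData.galois C.k C.K).tmPair.Pi)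
    (hΔ : ∀ f : S.PiX ≃ₜ* S.PiX, S.DeltaX.map f.toMulEquiv.toMonoidHom = S.DeltaX)
    (hq : Nonempty (TopGroup.quot S.PiX S.DeltaX ≃ₜ* S.Gk)) (Γ : Type) [Group Γ] :
    ∃ A : AbsTopMonoids S, (∀ G, A.Otri G = (ModelMLFGaloisData.galois C.k C.K).tmPair.M) ∧ Nonempty (ProfiniteGroupifications A Γ) :=
  ⟨AbsTopMonoids.genuineOfModel S C ε hΔ hq, fun _ => rfl, nonempty_genuineOfModel S C ε hΔ hq Γ⟩

end ProfiniteGroupifications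

end Literature.IUT.HodgeArakelov
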